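import Summits.BirchSwinnertonDyer.BirchSwinnertonDyer.Theorems.EisensteinPrimesAcTwistDeformationSurAtVbar
import Summits.BirchSwinnertonDyer.BirchSwinnertonDyer.Theorems.EisensteinPrimesAcTwistDeformationCotorsion
import HarnessLib

/-!
# STUB-IDEAS k3 g15 — `stub_heegnerIndexLowerAtTwo` (crux `SplitBadTwoLowerHalfOfFacts`, stmt-BirchSwinnertonDyer-27851)
# Typed sketch for the card `Ideas/stub-heegnerindexloweratwo-k3-g15.md`:
# «R111 IS A PORT, NOT RESEARCH» — the GV-surjectivity over the `v̄`-line at 2 (`S_{W*}(K*_∞) ↠ Loc_{v̄}`,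
# STUB-PLAN v3.3 R111, booked research-S/M with weak Leopoldt as open input) decomposes into
#   D-MODEL (typing S) ∧ D-LINE (typing S) ∧ [tree: cell bsd-eis road (A), p-free] ∧ D-SEAM (XS–S glue),
# with weak Leopoldt an OUTPUT of the corank squeeze and the surjectivity a COROLLARY of Greenberg 2016
# Prop. 2.6.3 (c) at `η := v` — all already kernel-checked for every prime `p` in
# `Theorems/EisensteinPrimesAcTwistDeformation{Cofree,LEO,SUR,Shapiro,Cotorsion,SurOfSUR,SurAtVbar}.lean`.
#
# §A  integer shadows of the squeeze / of the seam exactness (PROVED, omega).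
# §B  THE PORT: the bsd-eis arena instantiated at `p = 2` for an abstract line datum — PROVED (0 sorry) modulo the
#     by-name Greenberg facts and the two PrintCf2-specific inputs D-MODEL / D-LINE carried as hypotheses.
# §C  typed sub-stubs D-MODEL, D-LINE, D-SEAM as `Prop`s over existing declarations (+ one conversion lemma PROVED).
#
# HONEST FRAMING: nothing here proves BSD, the crux, the stub, or S3d; §B is conditional on the published named facts
# `prop263_sur_of_crk`, `prop41_globalEulerPoincareCorank`, `prop42_localEulerPoincareCorank`,
# `prop32_cohomology_isCofinitelyGenerated` (hypotheses) — `sec5A_localH2_subsingleton_of_LOC1` is PROVED in the tree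
# (`…_holds`) but is kept as a hypothesis to match the arena's binder list.
-/

set_option linter.dupNamespace false
set_option autoImplicit false

noncomputable section

open scoped Classical
open NumberField IsDedekindDomain Field Multiplicative PowerSeries
open Literature.NumberTheory.EllipticCurves Literature.NumberTheory.EllipticCurves.GreenbergSelmer
  Literature.NumberTheory.EllipticCurves.GreenbergVatsal2000 Literature.NumberTheory.GaloisRepresentations
  Literature.NumberTheory.EllipticCurves.KellerYin2024 Literature.NumberTheory.EllipticCurves.IwasawaDual
  Literature.NumberTheory.IwasawaTheory Literature.NumberTheory.IwasawaTheory.Greenberg2016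
  Literature.NumberTheory.IwasawaTheory.Greenberg2006
  Summit.BirchSwinnertonDyer.BirchSwinnertonDyer.Theorems.GreenbergFullAtSelmer
  Summit.BirchSwinnertonDyer.BirchSwinnertonDyer.Theorems.TwistDeformationCofree
  Summit.BirchSwinnertonDyer.BirchSwinnertonDyer.Theorems.AcTwistDeformation

namespace Summit.BirchSwinnertonDyer.BirchSwinnertonDyer.Cruxes.SplitBadTwoLowerHalfOfFacts.StubIdeasK3G15

/-! ## §A Integer shadows (the bookkeeping the arena performs with `HasCorank`; PROVED) -/

/-- **The corank squeeze on a corank-critical line** (Greenberg 2006 Prop. 4.1 shadow `h0 − h1 + h2 = −δ·m` with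
`δ·m = r₂·m = 1`, `h0 = 0`; exactness `0 → Sel → H¹ → Q` gives `h1 ≤ s + i`, `i ≤ q`; criticality `q = 1`;
TORS `s = 0`): then `h2 = 0` (weak Leopoldt / LEO is an OUTPUT), `h1 = 1`, and `i = q` (CRK). -/
theorem squeeze_shadow (h0 h1 h2 s i q : ℕ) (h41 : (h0 : ℤ) - h1 + h2 = -1) (hh0 : h0 = 0)
    (hex : h1 ≤ s + i) (hi : i ≤ q) (hq : q = 1) (hs : s = 0) : h2 = 0 ∧ h1 = 1 ∧ i = q := by
  omega

/-- **FAMILY-3 reading: a surjectivity defect forces non-torsion.** With the same bookkeeping, if the image corank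
`i` falls short of `q = 1` (¬CRK — the only way SUR can fail once LEO⁽ᶜ⁾-inputs hold), then `s ≥ 1`: the strict
dual Selmer module is NOT torsion — contradicting the S3d stub's own antecedent `Module.IsTorsion Dnr.X`. -/
theorem nonTorsion_of_corankDefect (h0 h1 h2 s i q : ℕ) (h41 : (h0 : ℤ) - h1 + h2 = -1) (hh0 : h0 = 0)
    (hex : h1 ≤ s + i) (hq : q = 1) (hdef : i < q) : 1 ≤ s := by
  omega

/-- **Seam exactness from two one-sided bounds**: k3-g14's sandwich gives `e ≤ E` (R110, typed); the surjectivity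
`S ↠ Loc_{v̄}` gives `char(Loc^∨) ∣ char((S/𝔖)^∨)`, hence `E ≤ e`; so `e = E` — the anchor bit of B20 is exact on
every member, not only at anchors. -/
theorem seam_exact_of_bounds (e E : ℕ) (hle : e ≤ E) (hge : E ≤ e) : e = E :=
  le_antisymm hle hge

/-- **Divisibility ⇒ valuation inequality at the constant term** (how `E ≤ e` is read off
`char(Loc^∨) ∣ char((S/𝔖)^∨)` in `ℤ₂⟦T⟧`): if `g ∣ f` and `f(0) ≠ 0` then `v(g(0)) ≤ v(f(0))`. -/
theorem valuation_constantCoeff_le_of_dvd {p : ℕ} [Fact p.Prime] {f g : PowerSeries ℤ_[p]} (hdvd : g ∣ f)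
    (hf0 : PowerSeries.constantCoeff f ≠ 0) :
    (PowerSeries.constantCoeff g).valuation ≤ (PowerSeries.constantCoeff f).valuation := by
  obtain ⟨h, rfl⟩ := hdvd
  rw [map_mul] at hf0 ⊢
  have hg : PowerSeries.constantCoeff g ≠ 0 := fun h0 ↦ hf0 (by rw [h0, zero_mul])
  have hh : PowerSeries.constantCoeff h ≠ 0 := fun h0 ↦ hf0 (by rw [h0, mul_zero])
  rw [PadicInt.valuation_mul hg hh]
  exact Nat.le_add_right _ _

/-! ## §B THE PORT — bsd-eis road (A) at `p = 2` for an abstract line datum (PROVED modulo by-name facts)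

Dictionary (EisensteinPrimes ↦ PrintCf2): `p ↦ 2`; `K ↦ K = ℚ(√−7)` (any imaginary quadratic `K` with `2 = v·v̄`);
`κ ↦ κ'` (the `v̄`-line: ANY `ℤ₂`-extension — no anticyclotomic hypothesis is used by the arena; only `hsup` =
D-LINE and a topological generator `γ'`); `A, ρ₀, ψ ↦` a `G_{K,S}`-model of `M = W* = W[v̄^∞]` (D-MODEL);
`𝔭 ↦ v` (RELAXED, the LOC⁽¹⁾-place `η` of Prop. 2.6.3 (c)); `𝔭bar ↦ v̄` (STRICT, the corank-one local factor);
`D ↦ Dnr` = the S3d stub's Greenberg–Vatsal datum of `S_{W*}(K*_∞) = datumSelmer κ'.ker W* 2 (bdpData W* 2 v̄) ∅`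
with its OWN antecedents `Module.Finite ∧ Module.IsTorsion` (= TORS); `S₀ ↦ {v̄}`.
-/

section Port

variable {K : Type} [Field K] [NumberField K] (S : Set (HeightOneSpectrum (𝓞 K)))
  {A : Type} [AddCommGroup A] [Module ℤ_[2] A] [TopologicalSpace A] [DiscreteTopology A]
  [TopologicalSpace (PowerSeries ℤ_[2])] [IsTopologicalRing (PowerSeries ℤ_[2])]
  [IsTopologicalAddGroup (BigRepModule ℤ_[2] 2 A)] [ContinuousSMul (PowerSeries ℤ_[2]) (BigRepModule ℤ_[2] 2 A)]
  (hS : ∀ v : HeightOneSpectrum (𝓞 K), ((2 : ℕ) : 𝓞 K) ∈ v.asIdeal → v ∈ S)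
  (κ : ZpExtension K 2) (ρ₀ : ContinuousRep (GaloisGroupUnramifiedOutside K S) ℤ_[2] A)
  {M : Type} [AddCommGroup M] [DistribMulAction (absoluteGaloisGroup K) M] [TopologicalSpace M]
  [DiscreteTopology M]
  (ψ : A ≃+ M) (hψ : ∀ (σ : absoluteGaloisGroup K) (a : A), ψ (ρ₀ (toUnramifiedQuot K S σ) a) = σ • ψ a)

include hS hψ in
/-- **R111-CORE AT 2 (the port).** For ANY `ℤ₂`-line `κ` of an imaginary quadratic `K` with `2 = v·v̄` in which no place of
`S` splits completely (D-LINE), ANY discrete `Γ_K`-module `M` modelled by a scalar `G_{K,S}`-action on `A ≃ ℚ₂/ℤ₂`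
(D-MODEL), and ANY finitely generated TORSION Greenberg–Vatsal datum `D` of the unramified-at-`v̄` line group
`S_M(K_∞) = datumSelmer (ker κ) M 2 (bdpData M 2 v̄) ∅` (the S3d stub's `Dnr` with its own antecedents): GRANTED Greenberg
2016 Prop. 2.6.3 and Greenberg 2006 Props. 4.1, 4.2, §5 A, 3.2 BY NAME, every family of local classes
`y i ∈ H¹(ker κ ⊓ D_v̄, M)` at the `2^c` places of `K_∞` above `v̄` is realised by ONE global class `u ∈ H¹(K_∞, M)` that is
unramified away from `2`, locally trivial above the places of `S ∖ {v, v̄}`, with `res_{ker κ ⊓ D_v̄}(conj_{γ^i} u) = y i`.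
Three tree theorems of cell bsd-eis, called at `p = 2` with NO change: `exists_shapiroDescent`,
`hasCorank_fullAtSelmer_zero_of_datumDualData` ([RH]-transport: TORS ⇒ `corank S_{𝓛_v}(K, 𝐃₁) = 0`),
`exists_mem_unramifiedOutside_forall_resOfLe_conjH1_eq` (squeeze ⇒ LEO ⇒ CRK ⇒ Prop. 2.6.3 (c) at `η = v` ⇒ SUR ⇒ Shapiro descent).
Weak Leopoldt for `M` over `K_∞` is nowhere assumed. -/
theorem lineSurjAtVbar_two (h263 : prop263_sur_of_crk) (h41 : prop41_globalEulerPoincareCorank)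
    (h42 : prop42_localEulerPoincareCorank) (h5A : sec5A_localH2_subsingleton_of_LOC1)
    (h32 : prop32_cohomology_isCofinitelyGenerated)
    (hSf : S.Finite) (hK : IsImaginaryQuadratic K) (e : A ≃ₗ[ℤ_[2]] QpModZp 2)
    (hscalar : ∀ g : GaloisGroupUnramifiedOutside K S, ∃ t : ℤ_[2]ˣ, ∀ a : A, ρ₀ g a = (t : ℤ_[2]) • a)
    (hsup : ∀ w : HeightOneSpectrum (𝓞 K), w ∈ S →
      ∃ σ : absoluteGaloisGroup (Place.Completion (Sum.inr w : Place K)), κ (absGaloisRestrict K _ σ) ≠ 1)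
    {v vbar : HeightOneSpectrum (𝓞 K)} (hne : vbar ≠ v)
    (hv : ((2 : ℕ) : 𝓞 K) ∈ v.asIdeal) (hvbar : ((2 : ℕ) : 𝓞 K) ∈ vbar.asIdeal)
    (hSp : ∀ w : HeightOneSpectrum (𝓞 K), ((2 : ℕ) : 𝓞 K) ∈ w.asIdeal → w = v ∨ w = vbar)
    (hA : ∀ a : A, ∃ k : ℕ, 2 ^ k • a = 0) (hMtor : ∀ m : M, ∃ k : ℕ, 2 ^ k • m = 0)
    (hMstab : ∀ m : M, IsOpen (MulAction.stabilizer (absoluteGaloisGroup K) m : Set (absoluteGaloisGroup K)))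
    {γ : absoluteGaloisGroup K} (hγ : κ.IsTopGenerator γ)
    (D : DatumDualData κ γ M (Castella2018.AcSelmer.bdpData M 2 vbar) (∅ : Set (HeightOneSpectrum (𝓞 K))))
    (hDfin : Module.Finite (IwasawaAlgebra 2) D.X) (hDtor : Module.IsTorsion (IwasawaAlgebra 2) D.X)
    {c : ℕ} (hd₀ : ∃ δ ∈ decomp (K := K) vbar, (κ δ).toAdd = (2 : ℤ_[2]) ^ c)
    (hdiv : ∀ δ ∈ decomp (K := K) vbar, (2 : ℤ_[2]) ^ c ∣ (κ δ).toAdd)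
    (y : ℕ → subgroupH1 (κ.kerSubgroup ⊓ decomp (K := K) vbar) M) :
    ∃ u : subgroupH1 κ.kerSubgroup M,
      u ∈ unramifiedOutside κ.kerSubgroup M 2 (↑({vbar} : Finset (HeightOneSpectrum (𝓞 K)))) ∧
      (∀ w : HeightOneSpectrum (𝓞 K), w ∈ S → w ≠ v → w ≠ vbar →
        ∀ σ : absoluteGaloisGroup K, conjH1 κ.kerSubgroup M σ u ∈ awayKer κ.kerSubgroup M w) ∧
      ∀ i : ℕ, i < 2 ^ c →
        resOfLe M (inf_le_left : κ.kerSubgroup ⊓ decomp (K := K) vbar ≤ κ.kerSubgroup)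
          (conjH1 κ.kerSubgroup M (γ ^ i) u) = y i := by
  -- the Shapiro descent `F : H¹(K_Σ/K, 𝐃₁) → H¹(K_∞, M)` of the model `ψ`
  obtain ⟨F, hF⟩ := exists_shapiroDescent S hS κ ρ₀ ψ hψ
  -- [RH]-transport: TORS ⇒ `corank_Λ S_{𝓛_v}(K, 𝐃₁) = 0`, `S_{𝓛_v}` cofinitely generated
  obtain ⟨hSel, hSelfg⟩ :=
    hasCorank_fullAtSelmer_zero_of_datumDualData S hS κ ρ₀ ψ hψ hA hMtor hMstab hγ hv hne hSp D hDfin hDtor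
  -- targets supported at `v̄`, representatives `γ^i`
  let y' : ∀ w : HeightOneSpectrum (𝓞 K), ℕ → subgroupH1 (κ.kerSubgroup ⊓ decomp (K := K) w) M :=
    fun w i ↦ if hw : w = vbar then hw ▸ y i else 0
  have hy' : ∀ i : ℕ, y' vbar i = y i := fun i ↦ by simp [y']
  have hσrep : ∀ w ∈ ({vbar} : Finset (HeightOneSpectrum (𝓞 K))), ∀ i : ℕ, i < 2 ^ (fun _ ↦ c) w →
      (κ ((fun (_ : HeightOneSpectrum (𝓞 K)) (i : ℕ) ↦ γ ^ i) w i)).toAdd = (i : ℤ_[2]) := fun w _ i _ ↦ by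
    change (κ (γ ^ i)).toAdd = (i : ℤ_[2])
    rw [map_pow, show κ γ = Multiplicative.ofAdd 1 from hγ, ← ofAdd_nsmul, toAdd_ofAdd, nsmul_one]
  have hvbarS : ∀ w ∈ ({vbar} : Finset (HeightOneSpectrum (𝓞 K))), w ∈ S := fun w hw ↦ by
    rw [Finset.mem_singleton] at hw
    subst hw
    exact hS w hvbar
  have hvbarv : ∀ w ∈ ({vbar} : Finset (HeightOneSpectrum (𝓞 K))), w ≠ v := fun w hw ↦ by
    rw [Finset.mem_singleton] at hw
    subst hw
    exact hne
  -- squeeze ⇒ LEO ⇒ CRK ⇒ Prop. 2.6.3 (c) at `η = v` ⇒ SUR ⇒ descent (ONE tree theorem, p-free)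
  obtain ⟨u, hunr, haway, hev⟩ := exists_mem_unramifiedOutside_forall_resOfLe_conjH1_eq S hS κ ρ₀ ψ hψ
    h263 h41 h42 h5A h32 hSf hK e hscalar hsup hne hv hvbar hSel hSelfg hA hF {vbar} hvbarS hvbarv (fun _ ↦ c)
    (fun w hw ↦ by rw [Finset.mem_singleton] at hw; subst hw; exact hdiv)
    (fun w hw ↦ by rw [Finset.mem_singleton] at hw; subst hw; exact hd₀) (fun _ i ↦ γ ^ i) hσrep y'
  refine ⟨u, hunr, fun w hw hwv hwvbar σ ↦ ?_, fun i hi ↦ (hev vbar (Finset.mem_singleton_self vbar) i hi).trans (hy' i)⟩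
  exact haway w hw hwv (fun hw' ↦ hwvbar (Finset.mem_singleton.mp hw')) σ

end Port

/-! ## §C Typed sub-stubs for the two PrintCf2-specific inputs and the seam glue -/

section SubStubs

variable {K : Type} [Field K] [NumberField K]

/-- **D-LINE (typing S; CFT on the `v̄`-line).** No place of `S` splits completely in `K*_∞`: the decomposition group
of every `w ∈ S` is not contained in `ker κ'`. For `K = ℚ(√−7)`, `h_K = 1`: at `v̄` the line is (totally) ramified;
at `v` and at `w ∣ 7d` the Frobenius acts on `W* ≅ ℚ₂/ℤ₂` by a `2`-adic unit of infinite order (`ψ_E(v) = π̄`,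
`ψ_E((√−7)) ∼ √−7`, `ψ_E(𝔮) ∼ ±q` or `α_𝔮`), so by `PrintCf2.RestrictedSelmerPair.mem_kerSubgroup_iff_smul_of_frame`
(`δ ∈ ker κ' ↔ δ` acts on `W*` by `±1`) it is not in `ker κ'`. -/
def LineFinitelyDecomposed (S : Set (HeightOneSpectrum (𝓞 K))) (κ : ZpExtension K 2) : Prop :=
  ∀ w ∈ S, ¬ (decomp (K := K) w ≤ κ.kerSubgroup)

/-- **D-LINE ⇒ the arena's `hsup`** (PROVED conversion: `D_w` is the image of `Γ_{K_w}`). -/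
theorem hsup_of_lineFinitelyDecomposed {S : Set (HeightOneSpectrum (𝓞 K))} {κ : ZpExtension K 2}
    (h : LineFinitelyDecomposed S κ) :
    ∀ w : HeightOneSpectrum (𝓞 K), w ∈ S →
      ∃ σ : absoluteGaloisGroup (Place.Completion (Sum.inr w : Place K)), κ (absGaloisRestrict K _ σ) ≠ 1 := by
  intro w hw
  by_contra hcon
  push Not at hcon
  refine h w hw fun δ hδ ↦ ?_
  obtain ⟨σ, rfl⟩ := (mem_decomp_iff w δ).mp hδ
  exact ZpExtension.mem_kerSubgroup.mpr (hcon σ)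

/-- **D-MODEL (typing S–M; NOS + `W* ≅ ℚ₂/ℤ₂`).** A Greenberg-arena model of the line coefficients `M = W*`: a discrete
`ℤ₂`-module `A ≃ ℚ₂/ℤ₂` with a continuous `G_{K,S}`-action by SCALARS and a `Γ_K`-equivariant identification `ψ : A ≃ M`
(for `W* = W[v̄^∞] = endEigenPrimaryTorsion 2 π r`: cyclic layers `W[v̄ⁿ] ≅ ℤ/2ⁿ` — cell lemma
`endEigenPrimaryTorsion_two_structure` — give `A ≅ ℚ₂/ℤ₂`; `End(ℚ₂/ℤ₂) = ℤ₂` makes every automorphism a unit scalar;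
unramified outside `S ⊇ {v, v̄} ∪ {w ∣ 7d}` by Néron–Ogg–Shafarevich, tree pattern
`SignedBaseChangeAcDivCurveModel.exists_continuousRep_primaryTorsion`). Stated for a given candidate `(A, ρ₀, ψ)`. -/
def ArenaModelAt (S : Set (HeightOneSpectrum (𝓞 K))) {A : Type} [AddCommGroup A] [Module ℤ_[2] A]
    [TopologicalSpace A] (ρ₀ : ContinuousRep (GaloisGroupUnramifiedOutside K S) ℤ_[2] A)
    {M : Type} [AddCommGroup M] [DistribMulAction (absoluteGaloisGroup K) M] (ψ : A ≃+ M) : Prop :=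
  Nonempty (A ≃ₗ[ℤ_[2]] QpModZp 2) ∧
    (∀ (σ : absoluteGaloisGroup K) (a : A), ψ (ρ₀ (toUnramifiedQuot K S σ) a) = σ • ψ a) ∧
    (∀ g : GaloisGroupUnramifiedOutside K S, ∃ t : ℤ_[2]ˣ, ∀ a : A, ρ₀ g a = (t : ℤ_[2]) • a)

/-- **D-SEAM (glue, XS–S; the only NEW statement of the decomposition).** The K_∞-side surjectivity of §B, read in the
LEAD's seam currency: every family of UNRAMIFIED local classes at the places above `v̄` lifts to the unramified-at-`v̄`
line group `S_M(K*_∞) = datumSelmer (ker κ') M 2 (bdpData M 2 v̄) ∅` (membership = `unramifiedOutside … ∅` ∧ Greenberg's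
inertia condition at `v̄`, `relaxedDatum` at `v` — `GreenbergVatsal2000.datumSelmer`, `Castella2018.AcSelmer.bdpData_self/_of_ne`,
`greenbergKer_relaxedDatum_eq_top`; the `v̄`-condition for all `σ` from the one for `γ^i`, `i < 2^c`, by
`σ = h·γ^i·δ`, `h ∈ ker κ'`, `δ ∈ D_v̄` — pattern `AcTwistDeformation.shapiroDescent_mem_unrSelmer_of_mem_fullAtSelmer`).
Consequence with k3-g14's sandwich (R110): `S_M(K*_∞) ⧸ 𝔖_{v̄}(K*_∞, M) ↠ Loc_{v̄}`, `char(Loc_{v̄}^∨) ∣ char((S/𝔖)^∨)`,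
`e_δ = E(key)` EXACTLY on every member (`seam_exact_of_bounds`, `valuation_constantCoeff_le_of_dvd`). -/
def SeamLift (κ : ZpExtension K 2) (M : Type) [AddCommGroup M] [DistribMulAction (absoluteGaloisGroup K) M]
    [TopologicalSpace M] [DiscreteTopology M] (vbar : HeightOneSpectrum (𝓞 K)) (γ : absoluteGaloisGroup K) (c : ℕ) :
    Prop :=
  ∀ y : ℕ → subgroupH1 (κ.kerSubgroup ⊓ decomp (K := K) vbar) M,
    (∀ i : ℕ, i < 2 ^ c → y i ∈ GreenbergVatsal2000.unramifiedKer (κ.kerSubgroup ⊓ decomp (K := K) vbar) M vbar) →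
    ∀ u : subgroupH1 κ.kerSubgroup M,
      u ∈ unramifiedOutside κ.kerSubgroup M 2 (↑({vbar} : Finset (HeightOneSpectrum (𝓞 K)))) →
      (∀ i : ℕ, i < 2 ^ c →
        resOfLe M (inf_le_left : κ.kerSubgroup ⊓ decomp (K := K) vbar ≤ κ.kerSubgroup)
          (conjH1 κ.kerSubgroup M (γ ^ i) u) = y i) →
      u ∈ datumSelmer κ.kerSubgroup M 2 (Castella2018.AcSelmer.bdpData M 2 vbar) (∅ : Set (HeightOneSpectrum (𝓞 K)))

end SubStubs

end Summit.BirchSwinnertonDyer.BirchSwinnertonDyer.Cruxes.SplitBadTwoLowerHalfOfFacts.StubIdeasK3G15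

end
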